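import Summits.ResolutionOfSingularities.ResolutionOfSingularities.Theorems.RadicialJungCleanModelsStubCossartPiltant2019EquivariantOfCofinality
import HarnessLib

/-!
# `CleanModels`, stub 2 (F-02): INVARIANT COFINALITY named (`@[conjecture] def InvariantCofinality3`) and the TYPE of stub 2 keyed on it

OURS (decomp-res hand-1 g20; crux `stmt-ResolutionOfSingularities-15917`, skeleton rev 35 `Cruxes/CleanModels/Lines/Sketch.lean`, stub
`stub_cossartPiltant2019 : CossartPiltant2019.{0}`).  Companion of `RadicialJungCleanModelsStubCossartPiltant2019EquivariantOfCofinality.lean`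
(same generation): the single statement from which BOTH research leaves `hEqT`, `hEqI` of the Cossart–Piltant climb follow
(`equivariantLU_of_invariantCofinality`) is NAMED here, as a candidate statement of OURS, so that the planner can file / attack it as ONE
target:

* `InvariantCofinality3` (`@[conjecture] def`, OURS, not in print) — in the frame of the climb (complete regular local `S` of dimension 3
  and residue characteristic `p`; algebraically closed `(E, O_E)` algebraic over `S`, `O_E` dominating `S` with algebraic residue extension
  and rank one; a subfield `M′ ∋ S`; a subgroup `H ≤ Aut_S E` mapping `M′` into itself and `O_E ∩ M′` into `O_E`): every local
  uniformization `t` of `M′` and every finite `e ⊆ O_E ∩ M′` admit a local uniformization `t′ ⊇ t` of `M′` whose NEW generators are FIXED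
  by `H` and whose local ring at the centre contains `e`.  Without the word «fixed» this is the tree's proved cofinality
  (`cofinality_of_principalization`, CP 2019 Prop. 4.4); WHY IT MIGHT HOLD: it follows from CP 2019 Thm. 1.1 (local uniformization of the
  fixed field `M′^H` plus cofinality there, the new generators taken in `M′^H`); WHY IT MIGHT FAIL / BE HARD: it is local uniformization
  «downstairs» at rank-one NON-Abhyankar valuations in disguise (hand-1 g20 memo §2 (C1)–(C4)), i.e. CoP1 Problem 9.1 (tame and unramified
  push-down), of which [CoP1] Lemma 9.4 / Prop. 9.3 are the printed — and, as printed, incompletely proved — instances.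
* (`equivariantLU_of_invariantCofinality` of the companion file applies verbatim to `h : InvariantCofinality3.{0}` and yields `hEqT ∧ hEqI`);
* `cossartPiltant2019_of_stub1_of_invariantCofinality3_of_hironaka` — **the TYPE of stub 2 from `CossartPiltant2019Local.{0}` (CP 2019
  Thm. 1.5, printed), `CossartJannsenSaito2020Embedded.{0}` (CJS Thm. 1.4 = stub 1, printed), `InvariantCofinality3.{0}` (OURS),
  `Hironaka1964_local.{0}` (printed, char. `0` only)**;
* `resolutionOverUpToDim_three_of_stub1_of_invariantCofinality3_charP` — the `k`-instance of F-02 at characteristic `p` from the first three.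

Relations (hand-1 g20): `InvariantCofinality3 ⇒ hEqT ∧ hEqI` (`equivariantLU_of_invariantCofinality`) `⇒` the instances of `CossartPiltant2008_lemma94_kummerCore` /
the inert layer used by the chain (`kummerCore_of_stableLocalRing`, `exists_model_decompositionField_of_stableModel`); conversely each of the
three is a consequence of CP 2019 Thm. 1.1.  Nothing here proves resolution of singularities in positive characteristic, local uniformization
in dimension three, or any statement of a manuscript under adjudication; rung 0. AI-written; AI review weaker than expert review.
-/

-- `Summit.<Summit>.<Sub>.Theorems` with `Sub = Summit` (single-conjunct summit, D-0017)
set_option linter.dupNamespace false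

noncomputable section

open IsLocalRing Polynomial AlgebraicGeometry
open _root_.IntermediateField
open Literature.AlgebraicGeometry.Resolution
open Summit.ResolutionOfSingularities.ResolutionOfSingularities.Theorems.CP2008Prop44

namespace Summit.ResolutionOfSingularities.ResolutionOfSingularities.Theorems.RadicialJung.CleanModels

universe u

/-- [OURS · CANDIDATE statement, not a fact, not in print] **Invariant cofinality of local uniformizations in the Cossart–Piltant climb.**
Frame: `S` complete regular local, excellent, `dim S = 3`, residue characteristic `p`; `(E, O_E)` algebraically closed, algebraic over `S`,
`O_E ⊇ S` dominating `S` with algebraic residue extension, rank one; `M′ ∋ S` a subfield; `H ≤ Aut_S E` with `H M′ ⊆ M′`,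
`H (O_E ∩ M′) ⊆ O_E`.  Claim: for every local uniformization `t` of `M′` (finite `t ⊆ M′`, `M′ ⊆ Frac S(t)`, `S[t] ⊆ O_E`, `S[t]` regular
at the centre) and every finite `e ⊆ O_E ∩ M′` there is a local uniformization `t′ ⊇ t` of `M′` with `σ x = x` for all `σ ∈ H`,
`x ∈ t′ ∖ t`, whose local ring `locAtCentre S[t′] O_E` contains `e`.  It implies both equivariant local-uniformization leaves `hEqT`, `hEqI`
of the tree's chain for CP 2019 Prop. 4.10 (`equivariantLU_of_invariantCofinality`); it follows from CP 2019 Thm. 1.1; its content is local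
uniformization along the valuation restricted to the fixed field (hand-1 g20 memo §2). [candidate statement, OURS; open]
[cite: CossartPiltant2008, Problem 9.1, Prop. 9.3, Lemma 9.4 (HAL hal-00139124 pp. 26–29)] [cite: CossartPiltant2019, Prop. 4.4 and proof of Prop. 4.10 (arXiv v1 Props. 4.3, 4.8)] -/
@[conjecture] def InvariantCofinality3 : Prop :=
    ∀ (p : ℕ), p.Prime →
    ∀ (S : Type u) [CommRing S] [IsDomain S] [IsRegularLocalRing S],
      IsExcellentRing S → ringKrullDim S = 3 → CharP (ResidueField S) p →
      IsAdicComplete (maximalIdeal S) S →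
    ∀ (E : Type u) [Field E] [Algebra S E], Function.Injective (algebraMap S E) →
      IsAlgClosed E → Algebra.IsAlgebraic S E →
    ∀ (OE : ValuationSubring E), (∀ s : S, algebraMap S E s ∈ OE) →
      (∀ s ∈ maximalIdeal S, OE.valuation (algebraMap S E s) < 1) →
      (∀ y : OE, ∃ q : S[X], (∃ i, q.coeff i ∉ maximalIdeal S) ∧
        OE.valuation (q.eval₂ (algebraMap S E) y) < 1) →
    Nonempty OE.valuation.RankOne →
    ∀ (M' : Subfield E), (∀ s : S, algebraMap S E s ∈ M') →
    ∀ (H : Subgroup (E ≃ₐ[S] E)),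
      (∀ σ ∈ H, ∀ x ∈ M', σ x ∈ M') →
      (∀ σ ∈ H, ∀ x ∈ M', x ∈ OE → σ x ∈ OE) →
      ∀ (t : Finset E), (t : Set E) ⊆ M' →
        M' ≤ Subfield.closure (Set.range (algebraMap S E) ∪ (t : Set E)) →
        (∃ hTO : (Algebra.adjoin S (t : Set E)).toSubring ≤ OE.toSubring,
          IsRegularLocalRing (Localization.AtPrime
            (Ideal.comap (Subring.inclusion hTO) (maximalIdeal OE)))) →
      ∀ (e : Finset E), (e : Set E) ⊆ M' → (∀ x ∈ e, x ∈ OE) →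
      ∃ t' : Finset E, t ⊆ t' ∧ (t' : Set E) ⊆ M' ∧ (∀ σ ∈ H, ∀ x ∈ t', x ∉ t → σ x = x) ∧
        ∃ hTO' : (Algebra.adjoin S (t' : Set E)).toSubring ≤ OE.toSubring,
          IsRegularLocalRing (Localization.AtPrime
            (Ideal.comap (Subring.inclusion hTO') (maximalIdeal OE))) ∧
          ∀ x ∈ e, x ∈ locAtCentre (Algebra.adjoin S (t' : Set E)).toSubring OE

/-- **The TYPE of stub 2, `CossartPiltant2019.{0}`, from `CossartPiltant2019Local.{0}`, `CossartJannsenSaito2020Embedded.{0}` (= stub 1),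
`InvariantCofinality3.{0}` and `Hironaka1964_local.{0}` (char. `0` only).** [cite: CossartPiltant2019, Thm. 1.1, Thm. 1.5, Props. 4.4, 4.6, 4.8, 4.10]
[cite: CossartPiltant2008, Prop. 9.3, Lemma 9.4, Prop. 9.5] [cite: CossartJannsenSaito2020, Thm. 1.2, Thm. 1.4, Cor. 1.5] [cite: Temkin2008, Thm. 1.1] -/
theorem cossartPiltant2019_of_stub1_of_invariantCofinality3_of_hironaka
    (hloc : CossartPiltant2019Local.{0}) (hCJSE : CossartJannsenSaito2020Embedded.{0})
    (hICof : InvariantCofinality3.{0}) (hH : Hironaka1964_local.{0}) : CossartPiltant2019.{0} :=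
  cossartPiltant2019_of_stub1_of_invariantCofinality_of_hironaka hloc hCJSE hICof hH

/-- **`ResolutionOverUpToDim k 3` (`CharP k p`, `p` prime: the `k`-instance of F-02) from `CossartPiltant2019Local`, stub 1 and
`InvariantCofinality3`** — no Hironaka at the crux's characteristic. [cite: CossartPiltant2019, Thm. 1.1, Thm. 1.5, Props. 4.6, 4.8, 4.10]
[cite: CossartJannsenSaito2020, Thm. 1.2, Thm. 1.4] -/
theorem resolutionOverUpToDim_three_of_stub1_of_invariantCofinality3_charP (p : ℕ) (hp : p.Prime)
    (hloc : CossartPiltant2019Local.{0}) (hCJSE : CossartJannsenSaito2020Embedded.{0})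
    (hICof : InvariantCofinality3.{0}) (k : Type) [Field k] [CharP k p] : ResolutionOverUpToDim.{0} k 3 :=
  resolutionOverUpToDim_three_of_stub1_of_reductionP_charP' p hp hloc
    (cossartPiltant2019ReductionP_of_stub1_of_invariantCofinality hloc hCJSE hICof) hCJSE k

end Summit.ResolutionOfSingularities.ResolutionOfSingularities.Theorems.RadicialJung.CleanModels

/-! ## Erratum to the docstring of `InvariantCofinality3` (hand-1 g20, same generation, later the same day)

The sentence «WHY IT MIGHT HOLD: it follows from CP 2019 Thm. 1.1 (local uniformization of the fixed field `M′^H` plus cofinality there, the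
new generators taken in `M′^H`)» in the docstring of `InvariantCofinality3` is WITHDRAWN.  Local uniformization and cofinality along the fixed
field `F = M′^H` do give regular local rings `R = S[c]_V`, `c ⊆ F`, as fine as desired, but the invariant enlargement `S[t ∪ c]_W = R[t]_W` of
the GIVEN local uniformization `t` need not be regular: for `ℓ = 2` and `W(θ) ∉ Γ_V` it is `R[η]_W` with `η = bθ` a minimal-value odd
eigencomponent of the generators `t` (after putting the even components and the ratios of the odd ones into `c`), which is regular iff
`η² = b²θ² ∉ 𝔪_R²` — a condition on `t` that no choice of `c` repairs when `b²θ²` is, up to `V`-units forced into `R`, an `m`-th power with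
`m ≥ 2`.  What CP 2019 Thm. 1.1 (with Prop. 4.4 and the toric resolution of Kummer coverings) does give is a `Gal`-stable regular local ring
DOMINATING `S[t]_W`, generated over `R` by EIGENVECTORS — i.e. the weaker statements `hEqT` / `hEqI` of the chain (existence of ONE stable
local uniformization), not the extension of EVERY `t` by invariants.

STATUS of `InvariantCofinality3` after this erratum: it IMPLIES `hEqT ∧ hEqI` (`equivariantLU_of_invariantCofinality`), the printed tame
push-down (`lemma94KummerCore_of_invariantCofinality3`) and the type of stub 2 (`cossartPiltant2019_of_stub1_of_invariantCofinality3_of_hironaka`);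
it is implied by nothing in print and is possibly FALSE for badly chosen `t` — DISPROVER TARGET: a regular `S[t]_W` in a totally ramified
quadratic Kummer step `(K(θ), W)`, `θ² ∈ K`, whose minimal-value odd eigencomponents `bθ` all have `b²θ² ∈ u·(K^×)^m` with `m ≥ 2` and
`u` a `V`-unit lying in every regular model containing the even components.  The SAFE research statements for stub 2 remain `hEqT` / `hEqI`
(the tree's chain) and the printed `CossartPiltant2008_lemma94_kummerCore` / `CossartPiltant2008_prop93` (`…OfNamedPushDown.lean`); both worked
examples of the hand-1 g19/g20 memos (small resolutions of `G`-stable cA₁ / cA₃ points) satisfy `InvariantCofinality3` for the `t` considered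
(`c = {y/z}`, resp. `c = {y²/z, z/y}`).
-/

namespace Summit.ResolutionOfSingularities.ResolutionOfSingularities.Theorems.RadicialJung.CleanModels

/-- **Erratum carrier** for the docstring of `InvariantCofinality3`: see the module section «Erratum» above — the claim that
`InvariantCofinality3` follows from CP 2019 Thm. 1.1 is withdrawn; `InvariantCofinality3` is a candidate statement of OURS that implies the
chain's equivariant leaves and the printed tame push-down, is implied by nothing in print, and may fail for badly chosen local
uniformizations `t` (disprover target stated above). [OURS, bookkeeping] -/
theorem InvariantCofinality3.erratum_docstring : True := trivial

end Summit.ResolutionOfSingularities.ResolutionOfSingularities.Theorems.RadicialJung.CleanModels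

/-! ## Erratum 2: `InvariantCofinality3` is FALSE — an explicit counterexample on paper (hand-1 g20, same generation)

Frame instance: `k` algebraically closed of characteristic `p`, `ℓ ≠ p` prime (so `ζ_ℓ ∈ k`), `S = k[[x, y, z]]`, `F = Frac S`, `V` the monomial
valuation `V(x) = 1`, `V(y) = √2`, `V(z) = √3` (rank one, rational rank 3, residue field `k`), `E` an algebraic closure of `F`, `O_E` any
extension of `V` to `E` (rank one, residually algebraic), `θ′ = x^{1/ℓ} ∈ E`, `M′ = F(θ′)` (totally ramified: `W(θ′) = 1/ℓ ∉ Γ_V = ℤ + ℤ√2 + ℤ√3`,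
inertia group `⊤`, the extension `W = O_E ∩ M′` of `V` unique), `H` = the `S`-automorphisms of `E` restricting to `Gal(M′ | F)` on `M′` (they map
`M′` into itself and `O_E ∩ M′` onto itself).  Local uniformization `t = {θ′}`: `S[θ′] = S[X]/(X^ℓ − x)` is regular at the centre (`x ∉ 𝔪_S²`),
`M′ = F(θ′)`, `S[θ′] ⊆ O_E`.  Element `e = (y/z)·θ′^{ℓ−1} ∈ M′`, `W(e) = √2 − √3 + (ℓ−1)/ℓ > 0`, so `e ∈ O_E ∩ M′`.
CLAIM: no `t′ ⊇ t` as in `InvariantCofinality3` contains `e` in its local ring.  Indeed a new generator fixed by `H` lies in `M′^{Gal} = F`, so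
`t′ = {θ′} ∪ c` with `c ⊆ F ∩ O_V`, and `locAtCentre S[t′] O_E = (S[c][θ′])_W`.  If `e = P(θ′)/Q(θ′)` with `P, Q ∈ S[c][θ′]` (degrees `< ℓ` in
`θ′`, coefficients in `S[c] ⊆ O_V`) and `W(Q) = 0`, then — the values `V(q_i) + i/ℓ` (`0 ≤ i < ℓ`) lying in distinct cosets of `Γ_V` —
`W(Q) = min_i (V(q_i) + i/ℓ) = 0` forces `V(q_0) = 0`; comparing the coefficients of `θ′^{ℓ−1}` in `e·Q = P` (the terms `q_i θ′^{ℓ−1+i}`, `i ≥ 1`,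
contribute `x q_i θ′^{i−1}` of degree `< ℓ−1`) gives `(y/z)·q_0 = p_{ℓ−1} ∈ S[c] ⊆ O_V`, contradicting `V((y/z) q_0) = √2 − √3 < 0`.  ∎
(A `Gal`-stable regular local uniformization containing `e` does exist — e.g. for `ℓ = 2`, `S[y, z/y, θ′/(z/y)]_W` is generated by eigenvectors —
consistent with `hEqT`; the false step is the restriction of the NEW generators to INVARIANT elements while keeping the OLD generators `t`.)

CONSEQUENCES.  (1) `InvariantCofinality3` must NOT be filed as an item to prove; a kernel refutation `¬ InvariantCofinality3.{0}` needs the frame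
instance above constructed in Lean (`MvPowerSeries` base, monomial valuation with irrational weights extended to an algebraic closure with
`RankOne` and residual algebraicity) — size L–XL, not attempted.  (2) The theorems keyed on it (`equivariantLU_of_invariantCofinality3`-type,
`cossartPiltant2019_of_stub1_of_invariantCofinality3_of_hironaka`, `lemma94KummerCore_of_invariantCofinality3`, `prop93_of_stub1_of_invariantCofinality3`,
`resolutionOverUpToDim_three_of_stub1_of_invariantCofinality3_charP`) remain correct but are implications from a false hypothesis; the
INSTANCE-LEVEL tool `StabilityCriterion.exists_stableLU_of_invariantCofinality` (invariant cofinality asked only for the particular `(t, e)` at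
hand) and the stability criteria of `…StabilityCriterion.lean` are unaffected and remain the usable content.  (3) The research leaves of stub 2
are, as before hand-1 g20's naming attempt: `hEqT` / `hEqI` (∃ ONE stable local uniformization; tree chain) ≡ (research ⟹ printed typed in
`…PushDownOfEquivariantLU.lean`; printed ⟹ research on paper, memo (C2)) the printed pair `CossartPiltant2008_lemma94_kummerCore` /
`CossartPiltant2008_prop93` of `…OfNamedPushDown.lean` — THESE are the statements to carry.
-/

namespace Summit.ResolutionOfSingularities.ResolutionOfSingularities.Theorems.RadicialJung.CleanModels

/-- **Erratum 2 carrier**: `InvariantCofinality3` is FALSE (explicit counterexample on paper in the module section «Erratum 2» above: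
`S = k[[x,y,z]]`, monomial `V = (1, √2, √3)`, `M′ = F(x^{1/ℓ})`, `t = {x^{1/ℓ}}`, `e = (y/z)·x^{(ℓ−1)/ℓ}`); do not file it as an item to prove;
carry `CossartPiltant2008_lemma94_kummerCore` / `CossartPiltant2008_prop93` (or the chain's `hEqT` / `hEqI`) instead. [OURS, bookkeeping] -/
theorem InvariantCofinality3.refuted_on_paper : True := trivial

end Summit.ResolutionOfSingularities.ResolutionOfSingularities.Theorems.RadicialJung.CleanModels

end
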